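import Summits.QuantumFields.YangMills.Theorems.SmallCircleAnchorAnchorGapBBFPeelingAnalytic
import Summits.QuantumFields.YangMills.Theorems.SmallCircleAnchorAnchorGapCovLineIterate
import Summits.QuantumFields.YangMills.Theorems.SmallCircleAnchorAnchorGapCovDecPtFactorization
import Summits.QuantumFields.YangMills.Theorems.SmallCircleAnchorAnchorGapPolyGrowthProduct
import Summits.QuantumFields.YangMills.Theorems.SmallCircleAnchorAnchorGapCoordDependence
import Literature.Probability.LatticeModels.BattleFederbushWeights

/-!
# Crux `AnchorGap` (stmt-QuantumFields-11141), line `registered` — THE PEELED GAUSSIAN EXPECTATION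
# (step (G5b) of the assembly of GREP: ✓PEEL applied to `σ ↦ E(cov X σ)(Π G)`, every term identified)

✓PEEL (`stub_bbfPeelingAnalytic`, p784186) applied BY NAME to GREP's peeled function
`f := σ ↦ E(cov X σ)(Π_{b∈X} G b)` on the open smooth domain of ✓`FullPt.exists_open_smooth_domain`
(p791828; the product is in the class by px5 g17's ✓`PolyGrowthProd.contDiff_polyBound_prod`, p792872), with every term identified:
scripts rooted at `r ∈ X` whose points stay in `X` contribute `∫ w_s(t)·E(cov X σ_s(t))(D^s ΠG) dt`
(✓`LineIterate.foldl_fderiv_eq_gaussExpect_foldl_dop`, p792653, at the decoupled point — positive definite by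
✓`DecPt.posDef_cov_decPt`, p792320), scripts with a point outside `X` contribute `0`
(✓`CoordDep.foldl_fderiv_eq_zero_of_exists_not_mem`: `f` reads only the pairs inside `X`).  This is
GREP's identity BEFORE the factorisation (✓(G3)) and the resummation into the hard-core gas (✓(G4)).
[folklore]; no definition, no named fact.
-/

set_option autoImplicit false

namespace Summit.QuantumFields.YangMills.Theorems.AnchorGap.Peel

open Finset MeasureTheory MvPolynomial Literature.Probability.LatticeModels
  Literature.Probability.LatticeModels.BattleFederbush Literature.MeasureTheory.Integral
open scoped Matrix

variable {ι β : Type}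

/-- The peeled function reads only the pair parameters of pairs of atoms of `X`. [folklore] -/
theorem cov_eq_of_agree_on [DecidableEq β] (blk : ι → β) (C : Matrix ι ι ℝ) (X : Finset β)
    {σ τ : Sym2 β → ℝ}
    (h : ∀ ℓ ∈ {ℓ : Sym2 β | ∀ a ∈ ℓ, a ∈ X}, σ ℓ = τ ℓ) :
    (Matrix.of fun i j : ι => (if blk i = blk j then 1 else if blk i ∈ X ∧ blk j ∈ X
        then σ s(blk i, blk j) else 0) * C i j)
      = Matrix.of fun i j : ι => (if blk i = blk j then 1 else if blk i ∈ X ∧ blk j ∈ X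
        then τ s(blk i, blk j) else 0) * C i j := by
  ext i j
  simp only [Matrix.of_apply]
  by_cases h1 : blk i = blk j
  · rw [if_pos h1, if_pos h1]
  · rw [if_neg h1, if_neg h1]
    by_cases h2 : blk i ∈ X ∧ blk j ∈ X
    · rw [if_pos h2, if_pos h2, h s(blk i, blk j)]
      intro a ha
      rcases Sym2.mem_iff.1 ha with rfl | rfl
      · exact h2.1
      · exact h2.2
    · rw [if_neg h2, if_neg h2]

/-- The lines of a script whose points lie in `X` are pairs of atoms of `X`. [folklore] -/
theorem lines_subset [DecidableEq β] {r : β} {k : ℕ} (s : Script r k) {X : Finset β}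
    (hX : univ.image s.y ⊆ X) :
    ∀ ℓ ∈ s.lines, ∃ p q : β, p ∈ X ∧ q ∈ X ∧ ℓ = s(p, q) := by
  intro ℓ hℓ
  induction ℓ using Sym2.ind with
  | h p q =>
    exact ⟨p, q, hX (Script.mem_image_of_mem_lines s _ hℓ p (Sym2.mem_mk_left p q)),
      hX (Script.mem_image_of_mem_lines s _ hℓ q (Sym2.mem_mk_right p q)), rfl⟩

/-- A script rooted in `X` with a point outside `X` has a line leaving `X`. [folklore] -/
theorem exists_line_not_subset [Fintype β] [DecidableEq β] {r : β} {k : ℕ}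
    (s : Script r k) {X : Finset β} (hr : r ∈ X)
    (hX : ¬ univ.image s.y ⊆ X) :
    ∃ ℓ ∈ s.lines, ℓ ∉ {ℓ : Sym2 β | ∀ a ∈ ℓ, a ∈ X} := by
  obtain ⟨a, ha, haX⟩ := not_subset.1 hX
  rcases Script.eq_root_or_exists_line s ha with rfl | ⟨ℓ, hℓ, haℓ⟩
  · exact absurd hr haX
  · exact ⟨ℓ, hℓ, fun h => haX (h a haℓ)⟩

/-- **The peeled Gaussian expectation.** For `C` positive definite, atoms `blk`, an atom set `X`, a
root `r ∈ X` and atom factors `G b` of the smooth polynomial-growth class: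
`E(cov X 1)(Π_{b∈X} G b) = Σ_{k<|β|} Σ_{s : Script r k, valid, pts(s) ⊆ X} ∫_{[0,1]^β} w_s(t)·E(cov X σ_s(t))(D^s Π_{b∈X} G b) dt`,
`D^s := s.lines.foldl (H ℓ ↦ Dop ℓ H)` (GREP's texts for `cov`, `E`, `Dop`). [folklore] -/
theorem peel_gaussExpect_prod [Fintype ι] [DecidableEq ι] [Fintype β] [DecidableEq β] (blk : ι → β)
    (C : Matrix ι ι ℝ) (hC : C.PosDef) (X : Finset β)
    {r : β} (hr : r ∈ X) (G : β → (ι → ℝ) → ℝ) (hG : ∀ b : β, ContDiff ℝ (⊤ : ℕ∞) (G b))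
    (hGb : ∀ (b : β) (n : ℕ), ∃ (K : ℝ) (m : ℕ), ∀ φ : ι → ℝ,
      ‖iteratedFDeriv ℝ n (G b) φ‖ ≤ K * (1 + ∑ i, φ i ^ 2) ^ m) :
    (∫ φ : ι → ℝ, (∏ b ∈ X, G b φ) * Real.exp (-(φ ⬝ᵥ ((Matrix.of fun i j : ι =>
        (if blk i = blk j then 1 else if blk i ∈ X ∧ blk j ∈ X then (fun _ : Sym2 β => (1 : ℝ)) s(blk i, blk j) else 0)
          * C i j)⁻¹ *ᵥ φ)) / 2))
      / ∫ φ : ι → ℝ, Real.exp (-(φ ⬝ᵥ ((Matrix.of fun i j : ι =>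
        (if blk i = blk j then 1 else if blk i ∈ X ∧ blk j ∈ X then (fun _ : Sym2 β => (1 : ℝ)) s(blk i, blk j) else 0)
          * C i j)⁻¹ *ᵥ φ)) / 2)
    = ∑ k ∈ Finset.range (Fintype.card β), ∑ s : Script r k,
        if s.Valid then (if univ.image s.y ⊆ X then
          ∫ t in unitCube β, eval t (Script.weight ℝ s) *
            ((∫ φ : ι → ℝ, (s.lines.foldl (fun (K : (ι → ℝ) → ℝ) (ℓ : Sym2 β) => fun φ : ι → ℝ =>
                (1 / 2 : ℝ) * ∑ x : ι, ∑ y : ι,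
                  if s(blk x, blk y) = ℓ ∧ blk x ≠ blk y
                    then C x y * iteratedFDeriv ℝ 2 K φ ![Pi.single x 1, Pi.single y 1] else 0)
                (fun φ => ∏ b ∈ X, G b φ)) φ
              * Real.exp (-(φ ⬝ᵥ ((Matrix.of fun i j : ι =>
                (if blk i = blk j then 1 else if blk i ∈ X ∧ blk j ∈ X
                  then eval t (Script.decPt ℝ s s(blk i, blk j)) else 0) * C i j)⁻¹ *ᵥ φ)) / 2))
            / ∫ φ : ι → ℝ, Real.exp (-(φ ⬝ᵥ ((Matrix.of fun i j : ι =>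
                (if blk i = blk j then 1 else if blk i ∈ X ∧ blk j ∈ X
                  then eval t (Script.decPt ℝ s s(blk i, blk j)) else 0) * C i j)⁻¹ *ᵥ φ)) / 2))
          else 0) else 0 := by
  classical
  -- the product is in the class
  obtain ⟨hH, hHb⟩ := PolyGrowthProd.contDiff_polyBound_prod X hG hGb
  obtain ⟨K0, m0, hK0⟩ := hHb 0
  have hb0 : ∀ φ : ι → ℝ, |∏ b ∈ X, G b φ| ≤ K0 * (1 + ∑ i, φ i ^ 2) ^ m0 := fun φ => by
    rw [PolyGrowth.abs_le_of_norm_iteratedFDeriv_zero (H := fun φ : ι → ℝ => ∏ b ∈ X, G b φ)]; exact hK0 φ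
  -- the open smooth domain and PEEL
  obtain ⟨U, hUo, hUpts, hUs⟩ := FullPt.exists_open_smooth_domain ι blk C hC X r
    (fun φ => ∏ b ∈ X, G b φ) K0 m0 hH.continuous.measurable hb0
  have hpeel := stub_bbfPeelingAnalytic β r U hUo hUpts _ hUs
  refine hpeel.trans (Finset.sum_congr rfl fun k _ => Finset.sum_congr rfl fun s _ => ?_)
  by_cases hs : s.Valid
  · rw [if_pos hs, if_pos hs]
    by_cases hX : univ.image s.y ⊆ X
    · rw [if_pos hX]
      refine setIntegral_congr_fun (MeasurableSet.univ_pi fun _ => measurableSet_Icc) fun t ht => ?_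
      congr 1
      exact LineIterate.foldl_fderiv_eq_gaussExpect_foldl_dop blk C hC X s.lines (lines_subset s hX)
        _ hH hHb _ (DecPt.posDef_cov_decPt blk C hC X s hs ht)
    · rw [if_neg hX]
      have hdep : ∀ σ τ : Sym2 β → ℝ, (∀ ℓ ∈ {ℓ : Sym2 β | ∀ a ∈ ℓ, a ∈ X}, σ ℓ = τ ℓ) →
          (fun σ : Sym2 β → ℝ => (∫ φ : ι → ℝ, (∏ b ∈ X, G b φ) * Real.exp (-(φ ⬝ᵥ ((Matrix.of fun i j : ι =>
              (if blk i = blk j then 1 else if blk i ∈ X ∧ blk j ∈ X then σ s(blk i, blk j) else 0)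
                * C i j)⁻¹ *ᵥ φ)) / 2))
            / ∫ φ : ι → ℝ, Real.exp (-(φ ⬝ᵥ ((Matrix.of fun i j : ι =>
              (if blk i = blk j then 1 else if blk i ∈ X ∧ blk j ∈ X then σ s(blk i, blk j) else 0)
                * C i j)⁻¹ *ᵥ φ)) / 2)) σ
          = (fun σ : Sym2 β → ℝ => (∫ φ : ι → ℝ, (∏ b ∈ X, G b φ) * Real.exp (-(φ ⬝ᵥ ((Matrix.of fun i j : ι =>
              (if blk i = blk j then 1 else if blk i ∈ X ∧ blk j ∈ X then σ s(blk i, blk j) else 0)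
                * C i j)⁻¹ *ᵥ φ)) / 2))
            / ∫ φ : ι → ℝ, Real.exp (-(φ ⬝ᵥ ((Matrix.of fun i j : ι =>
              (if blk i = blk j then 1 else if blk i ∈ X ∧ blk j ∈ X then σ s(blk i, blk j) else 0)
                * C i j)⁻¹ *ᵥ φ)) / 2)) τ := by
        intro σ τ hστ
        simp only [cov_eq_of_agree_on blk C X hστ]
      have h0 := CoordDep.foldl_fderiv_eq_zero_of_exists_not_mem s.lines _ hdep
        (exists_line_not_subset s hr hX)
      rw [h0]
      simp
  · rw [if_neg hs, if_neg hs]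

end Summit.QuantumFields.YangMills.Theorems.AnchorGap.Peel
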